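import Summits.MatrixMultiplication.MatrixMultiplication.Theorems.SoloBlindConjEReduction
import Summits.MatrixMultiplication.MatrixMultiplication.Theorems.SoloBlindTopLayerOlson

/-!
# The deletion identity and the lift for Kraft masses

Sub-programme (K₃) (Kraft inequality for zero-sum-free sequences over `𝔽₃`), H-good half (Conjecture E and its
layer-defect sharpening E♭).  For a family `h : ι → G` on `S` and a target `τ` the Kraft mass is
`E(τ; S) = ∑_{T ⊆ S, ∑_T h = τ} 2^{-|T|}` (`soloBlindMass`).

* `soloBlindLift_mass_insertNone` — THE DELETION IDENTITY: for the one-element extension `S·x` (realised on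
  `Option ι`, `none ↦ x`), `E(τ; S·x) = E(τ; S) + E(τ - x; S) / 2` (split the representations by `x ∈ T`).
* `soloBlindLift_mass_map` / `soloBlindLift_mass_eq_zero` — masses are invariant under an injective additive map,
  and a target outside its range has mass `0`; `soloBlindLift_mass_zero` — on a zero-sum-free `S` the target `0`
  has mass `1` (only the empty set represents it).
* THE LIFT.  `soloBlindLift h σ : Option (Option ι) → G × ZMod 3` adjoins `σ̃ = (σ, 0)` and `e = (0, 1)` to
  `i ↦ (h i, 0)`; with the lifted target `σ' = (σ, 1)`:
  `E(σ'; S·σ̃·e) = E(σ; S) / 2 + 1 / 4` (`soloBlindLift_mass`: the representations of `σ'` are the `T ∪ {e}`,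
  `T` a representation of `σ`, and `{σ̃, e}`), the lifted family is zero-sum free when `S` is and `σ` is H-good
  (`soloBlindLift_zsf`), and `σ'` is H-good (`soloBlindLift_hgood`).  Hence Conjecture E (`E ≤ 1/2`) and its
  equality cases are LIFT-INVARIANT (`soloBlindLift_le_half_iff`, `soloBlindLift_eq_half_iff`), and so is the
  layer-defect bound `B(ρ, c) = 1/2 + 2^{-ρ} - 2^{ρ-1-c}` of Conjecture E♭ (`soloBlindEFlatBound_lift`:
  `B(ρ+1, c+2) = B(ρ, c)/2 + 1/4`; the lift raises rank by one and core size by two).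
-/

set_option linter.dupNamespace false

namespace Summit.MatrixMultiplication.MatrixMultiplication.Theorems

open Finset

variable {ι : Type*} [DecidableEq ι]
variable {G : Type*} [AddCommGroup G] [DecidableEq G]
variable {G' : Type*} [AddCommGroup G'] [DecidableEq G']

omit [DecidableEq ι] in
/-- The Kraft mass as an indicator sum over the whole powerset. -/
theorem soloBlindLift_mass_eq_ite (h : ι → G) (S : Finset ι) (τ : G) :
    soloBlindMass h S τ = ∑ T ∈ S.powerset, if ∑ i ∈ T, h i = τ then (1 / 2 : ℚ) ^ T.card else 0 := by
  unfold soloBlindMass soloBlindSeqRepAll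
  rw [sum_filter]

/-- Sums over the powerset of `insertNone S` split into the subsets avoiding `none` (the `U.map some`) and the
subsets containing it (the `insertNone U`), `U ⊆ S`. -/
theorem soloBlindLift_sum_powerset_insertNone (S : Finset ι) (Φ : Finset (Option ι) → ℚ) :
    ∑ T ∈ (insertNone S).powerset, Φ T =
      ∑ U ∈ S.powerset, Φ (U.map Function.Embedding.some) + ∑ U ∈ S.powerset, Φ (insertNone U) := by
  rw [← sum_filter_add_sum_filter_not (insertNone S).powerset (fun T => none ∉ T) Φ]
  congr 1
  · symm
    refine sum_nbij' (fun U => U.map Function.Embedding.some) (fun T => eraseNone T) ?_ ?_ ?_ ?_ ?_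
    · intro U hU
      rw [mem_powerset] at hU
      rw [mem_filter, mem_powerset]
      refine ⟨?_, by simp⟩
      intro o ho
      rw [mem_map] at ho
      obtain ⟨i, hi, rfl⟩ := ho
      exact some_mem_insertNone.mpr (hU hi)
    · intro T hT
      rw [mem_filter, mem_powerset] at hT
      rw [mem_powerset]
      intro i hi
      exact some_mem_insertNone.mp (hT.1 (mem_eraseNone.mp hi))
    · intro U _
      exact eraseNone_map_some U
    · intro T hT
      rw [mem_filter] at hT
      rw [map_some_eraseNone, erase_eq_of_notMem hT.2]
    · intro U _
      rfl
  · symm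
    refine sum_nbij' (fun U => insertNone U) (fun T => eraseNone T) ?_ ?_ ?_ ?_ ?_
    · intro U hU
      rw [mem_powerset] at hU
      rw [mem_filter, mem_powerset, not_not]
      refine ⟨?_, none_mem_insertNone⟩
      intro o ho
      cases o with
      | none => exact none_mem_insertNone
      | some i => exact some_mem_insertNone.mpr (hU (some_mem_insertNone.mp ho))
    · intro T hT
      rw [mem_filter, mem_powerset] at hT
      rw [mem_powerset]
      intro i hi
      exact some_mem_insertNone.mp (hT.1 (mem_eraseNone.mp hi))
    · intro U _
      exact eraseNone_insertNone U
    · intro T hT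
      rw [mem_filter, not_not] at hT
      rw [insertNone_eraseNone, insert_eq_of_mem hT.2]
    · intro U _
      rfl

/-- THE DELETION IDENTITY.  For the one-element extension `S·x` on `Option ι` (`none ↦ x`, `some i ↦ h i`):
`E(τ; S·x) = E(τ; S) + E(τ - x; S) / 2` — a representation of `τ` either avoids `x` (a representation of `τ`
inside `S`) or is `{x} ∪ U` with `U ⊆ S` representing `τ - x`, one element shorter. -/
theorem soloBlindLift_mass_insertNone (h : ι → G) (x : G) (S : Finset ι) (τ : G) :
    soloBlindMass (fun o : Option ι => o.elim x h) (insertNone S) τ =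
      soloBlindMass h S τ + soloBlindMass h S (τ - x) / 2 := by
  rw [soloBlindLift_mass_eq_ite, soloBlindLift_sum_powerset_insertNone, soloBlindLift_mass_eq_ite,
    soloBlindLift_mass_eq_ite, sum_div]
  congr 1
  · refine sum_congr rfl fun U _ => ?_
    simp only [sum_map, Function.Embedding.some_apply, Option.elim_some, card_map]
  · refine sum_congr rfl fun U _ => ?_
    rw [sum_insertNone, card_insertNone]
    simp only [Option.elim_none, Option.elim_some]
    by_cases hc : ∑ i ∈ U, h i = τ - x
    · have hc' : x + ∑ i ∈ U, h i = τ := by rw [hc]; abel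
      rw [if_pos hc', if_pos hc, pow_succ]
      ring
    · have hc' : ¬ (x + ∑ i ∈ U, h i = τ) := fun e => hc (by rw [← e]; abel)
      rw [if_neg hc', if_neg hc]
      simp

omit [DecidableEq ι] in
/-- Masses are invariant under an injective additive map of the group. -/
theorem soloBlindLift_mass_map (φ : G →+ G') (hφ : Function.Injective φ) (h : ι → G) (S : Finset ι)
    (τ : G) : soloBlindMass (fun i => φ (h i)) S (φ τ) = soloBlindMass h S τ := by
  rw [soloBlindLift_mass_eq_ite, soloBlindLift_mass_eq_ite]
  refine sum_congr rfl fun T _ => ?_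
  rw [← map_sum]
  by_cases hc : ∑ i ∈ T, h i = τ
  · rw [if_pos hc, if_pos (by rw [hc])]
  · rw [if_neg hc, if_neg (fun e => hc (hφ e))]

omit [DecidableEq ι] [DecidableEq G] in
/-- A target outside the range of the map has mass `0`. -/
theorem soloBlindLift_mass_eq_zero (φ : G →+ G') (h : ι → G) (S : Finset ι) (τ' : G')
    (hτ : ∀ g, φ g ≠ τ') : soloBlindMass (fun i => φ (h i)) S τ' = 0 := by
  rw [soloBlindLift_mass_eq_ite]
  refine sum_eq_zero fun T _ => ?_
  rw [← map_sum, if_neg (hτ _)]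

/-- On a zero-sum-free `S` only the empty set represents `0`, so `E(0; S) = 1`. -/
theorem soloBlindLift_mass_zero (h : ι → G) (S : Finset ι)
    (zsf : ∀ T ⊆ S, T.Nonempty → ∑ i ∈ T, h i ≠ 0) : soloBlindMass h S 0 = 1 := by
  have hrep : soloBlindSeqRepAll h S 0 = {∅} := by
    ext T
    rw [soloBlind_mem_seqRepAll, mem_singleton]
    constructor
    · rintro ⟨hT, hsum⟩
      by_contra hne
      exact zsf T hT (nonempty_iff_ne_empty.mpr hne) hsum
    · rintro rfl
      simp
  unfold soloBlindMass
  rw [hrep, sum_singleton, card_empty, pow_zero]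

/-- THE LIFT family on `Option (Option ι)` with values in `G × ZMod 3`: `none ↦ e = (0, 1)`,
`some none ↦ σ̃ = (σ, 0)`, `some (some i) ↦ (h i, 0)`. -/
def soloBlindLift (h : ι → G) (σ : G) : Option (Option ι) → G × ZMod 3 :=
  fun o => o.elim ((0 : G), (1 : ZMod 3)) (fun o' => (AddMonoidHom.inl G (ZMod 3)) (o'.elim σ h))

omit [DecidableEq ι] [DecidableEq G] in
/-- Values of the lift. -/
theorem soloBlindLift_apply_none (h : ι → G) (σ : G) : soloBlindLift h σ none = (0, 1) := rfl

omit [DecidableEq ι] [DecidableEq G] in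
/-- Values of the lift. -/
theorem soloBlindLift_apply_some (h : ι → G) (σ : G) (o' : Option ι) :
    soloBlindLift h σ (some o') = (o'.elim σ h, 0) := rfl

/-- THE LIFT HALVES AND SHIFTS THE MASS: `E((σ,1); S·σ̃·e) = E(σ; S) / 2 + 1 / 4` for zero-sum-free `S`.
The representations of `(σ, 1)` are `T ∪ {e}` for `T` a representation of `σ` (mass `E(σ;S)/2`) and `{σ̃, e}`
(mass `1/4`); nothing else, because the last coordinate forces `e ∈ T'` and a representation through `σ̃`
leaves a zero-sum subset of `S`, which must be empty. -/
theorem soloBlindLift_mass (h : ι → G) (σ : G) (S : Finset ι)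
    (zsf : ∀ T ⊆ S, T.Nonempty → ∑ i ∈ T, h i ≠ 0) :
    soloBlindMass (soloBlindLift h σ) (insertNone (insertNone S)) (σ, 1) =
      soloBlindMass h S σ / 2 + 1 / 4 := by
  have hinj : Function.Injective (AddMonoidHom.inl G (ZMod 3)) := by
    intro a b e
    simpa using congrArg Prod.fst e
  have hout : ∀ g : G, (AddMonoidHom.inl G (ZMod 3)) g ≠ ((σ, 1) : G × ZMod 3) := by
    intro g e
    have h2 := congrArg Prod.snd e
    rw [AddMonoidHom.inl_apply] at h2
    change (0 : ZMod 3) = 1 at h2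
    exact absurd h2 (by decide)
  have hsub : ((σ, (1 : ZMod 3)) : G × ZMod 3) - ((0 : G), (1 : ZMod 3)) =
      (AddMonoidHom.inl G (ZMod 3)) σ := by
    rw [AddMonoidHom.inl_apply, Prod.mk_sub_mk, sub_zero, sub_self]
  unfold soloBlindLift
  rw [soloBlindLift_mass_insertNone, hsub,
    soloBlindLift_mass_eq_zero (AddMonoidHom.inl G (ZMod 3)) (fun o' : Option ι => o'.elim σ h)
      (insertNone S) (σ, 1) hout,
    soloBlindLift_mass_map (AddMonoidHom.inl G (ZMod 3)) hinj (fun o' : Option ι => o'.elim σ h)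
      (insertNone S) σ,
    soloBlindLift_mass_insertNone, sub_self, soloBlindLift_mass_zero h S zsf]
  ring

omit [DecidableEq ι] [DecidableEq G] in
/-- The lifted family is zero-sum free when `S` is zero-sum free and `σ` is H-good (`σ + Σ_T h ≠ 0` for all
`T ⊆ S`, i.e. `S·σ` is zero-sum free): the last coordinate excludes `e`, and what remains is `S·σ̃`. -/
theorem soloBlindLift_zsf (h : ι → G) (σ : G) (S : Finset ι)
    (zsf : ∀ T ⊆ S, T.Nonempty → ∑ i ∈ T, h i ≠ 0) (hσ : ∀ T ⊆ S, σ + ∑ i ∈ T, h i ≠ 0) :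
    ∀ T ⊆ insertNone (insertNone S), T.Nonempty → ∑ o ∈ T, soloBlindLift h σ o ≠ 0 := by
  unfold soloBlindLift
  refine soloBlindTLO_zsf_insertNone _ _ _ ?_ ?_
  · intro T hT hne e
    have h1 := soloBlindTLO_zsf_insertNone h σ S zsf hσ T hT hne
    have h3 := congrArg Prod.fst e
    simp only [Prod.fst_sum, AddMonoidHom.inl_apply, Prod.fst_zero] at h3
    exact h1 h3
  · intro T _ e
    have h2 := congrArg Prod.snd e
    simp only [Prod.snd_add, Prod.snd_sum, AddMonoidHom.inl_apply, Prod.snd_zero, sum_const_zero,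
      add_zero] at h2
    exact absurd h2 (by decide)

omit [DecidableEq G] in
/-- The lifted target `(σ, 1)` is H-good for the lifted family: every subset sum has last coordinate `0` or `1`,
so `(σ, 1) + Σ_T` has last coordinate `1` or `2`, never `0`. -/
theorem soloBlindLift_hgood (h : ι → G) (σ : G) (S : Finset ι) :
    ∀ T ⊆ insertNone (insertNone S),
      ((σ, 1) : G × ZMod 3) + ∑ o ∈ T, soloBlindLift h σ o ≠ 0 := by
  intro T _ e
  have h2 := congrArg Prod.snd e
  rw [Prod.snd_add, Prod.snd_sum, Prod.snd_zero] at h2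
  have h3 : ∀ o' : Option ι, (soloBlindLift h σ (some o')).2 = 0 := fun o' => rfl
  by_cases hn : none ∈ T
  · have hTeq : T = insertNone (eraseNone T) := by
      rw [insertNone_eraseNone, insert_eq_of_mem hn]
    rw [hTeq, sum_insertNone] at h2
    simp only [soloBlindLift_apply_none, h3, sum_const_zero, add_zero] at h2
    exact absurd h2 (by decide)
  · have hTeq : T = (eraseNone T).map Function.Embedding.some := by
      rw [map_some_eraseNone, erase_eq_of_notMem hn]
    rw [hTeq, sum_map] at h2
    simp only [Function.Embedding.some_apply, h3, sum_const_zero, add_zero] at h2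
    exact absurd h2 (by decide)

/-- CONJECTURE E IS LIFT-INVARIANT: `E ≤ 1/2` for the lifted pair iff for the original pair. -/
theorem soloBlindLift_le_half_iff (h : ι → G) (σ : G) (S : Finset ι)
    (zsf : ∀ T ⊆ S, T.Nonempty → ∑ i ∈ T, h i ≠ 0) :
    soloBlindMass (soloBlindLift h σ) (insertNone (insertNone S)) (σ, 1) ≤ 1 / 2 ↔
      soloBlindMass h S σ ≤ 1 / 2 := by
  rw [soloBlindLift_mass h σ S zsf]
  constructor <;> intro H <;> linarith

/-- EQUALITY CASES ARE LIFT-INVARIANT: the lifted pair is E-tight iff the original pair is. -/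
theorem soloBlindLift_eq_half_iff (h : ι → G) (σ : G) (S : Finset ι)
    (zsf : ∀ T ⊆ S, T.Nonempty → ∑ i ∈ T, h i ≠ 0) :
    soloBlindMass (soloBlindLift h σ) (insertNone (insertNone S)) (σ, 1) = 1 / 2 ↔
      soloBlindMass h S σ = 1 / 2 := by
  rw [soloBlindLift_mass h σ S zsf]
  constructor <;> intro H <;> linarith

/-- The layer-defect bound of CONJECTURE E♭: `B(ρ, c) = 1/2 + 2^{-ρ} - 2^{-(c + 1 - ρ)}` for a core of rank `ρ`
and size `c` (conjecturally `E(σ; S) ≤ B(ρ, c)`; `B ≤ 1/2` exactly when `c ≤ 2ρ - 1`, Olson's bound). -/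
def soloBlindEFlatBound (ρ c : ℕ) : ℚ :=
  1 / 2 + (1 / 2 : ℚ) ^ ρ - (1 / 2 : ℚ) ^ (c + 1 - ρ)

/-- THE E♭ BOUND IS LIFT-INVARIANT: the lift raises the rank by one and the core size by two, and
`B(ρ + 1, c + 2) = B(ρ, c) / 2 + 1 / 4` — the same affine map as on masses (`soloBlindLift_mass`). -/
theorem soloBlindEFlatBound_lift (ρ c : ℕ) (hρc : ρ ≤ c + 1) :
    soloBlindEFlatBound (ρ + 1) (c + 2) = soloBlindEFlatBound ρ c / 2 + 1 / 4 := by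
  unfold soloBlindEFlatBound
  have hc : c + 2 + 1 - (ρ + 1) = (c + 1 - ρ) + 1 := by omega
  rw [hc, pow_succ, pow_succ]
  ring

end Summit.MatrixMultiplication.MatrixMultiplication.Theorems
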